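import Literature.AlgebraicGeometry.ModuliOfAbelianVarieties.SiegelCMHomEqTupleIso
import Literature.AlgebraicGeometry.AbelianSchemes.IsLambdaOfAtAlongDualIsogeny
import Literature.AlgebraicGeometry.AbelianSchemes.AbelianSchemeIsLambdaOfAtBaseChange
import Literature.AlgebraicGeometry.AbelianSchemes.AbelianSchemeIsLambdaOfAtConjugateTransport
import Literature.AlgebraicGeometry.AbelianSchemes.AbelianSchemeFibreBaseChangeHom
import Literature.AlgebraicGeometry.AbelianSchemes.PolarizedAbelianSchemeWithLevelBaseChange
import Literature.AlgebraicGeometry.AbelianSchemes.SymplecticLiftOfIsogenyTower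
import Literature.AlgebraicGeometry.AbelianSchemes.AbelianSchemeDualRingAction
import Literature.AlgebraicGeometry.AbelianSchemes.AbelianSchemeDualIsogenyComp
import Literature.AlgebraicGeometry.AbelianSchemes.AbelianSchemeQuotientPolarizationIdentity
import Literature.AlgebraicGeometry.AbelianSchemes.PoincarePullbackKernelCountOfQuotient
import Literature.AlgebraicGeometry.AbelianSchemes.PolarizationUnitHypothesis
import HarnessLib

/-!
# The CM homomorphism read along a GLOBAL isomorphism of PEL tuples: the fibre of the global tuple iso at a special sheet point intertwines
# the endomorphisms — the `hact` input of rigidity over the thickened curve ([Milne2005ShimuraVarieties] §14 Prop. 14.12; [MumfordFogartyKirwan1994] Ch. 6–7)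

Topic `AlgebraicGeometry/ModuliOfAbelianVarieties`; namespace `Literature.AlgebraicGeometry.ModuliOfAbelianVarieties.SiegelAdelicMarking` (§1 in
`Literature.AlgebraicGeometry.AbelianSchemes.AbelianSchemeOver`, absolute names).  THEOREMS ONLY (no definition, no named fact, no instance, no notation, no
`sorry`).  Sequel of ★ `SiegelCMHomEqTupleIso` ((R-CM-3): the two-family kernel at a fibre iso `e : B′_{s′} ≅ B_{Spec σ ≫ x}`).  Cell `hodgecm-mathlib` (D-0151), FLOOR
0, P6 «MOD» (crux hLiu418 = stmt-HodgeConjecture-24832, `--supports`): the **(B3)-ADAPTER** of the (γ′) road for the E-sheet socket `hole_SHEET_complex` (LA7-p01 (g4)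
2026-09-02 09:09Z binder (B3)): LEG-E holds a GLOBAL isomorphism `E : B′ ≅ B ×_S S′` of PEL tuples over `S′` (`B′` the Serre-tensor family, `B ×_S S′` the
pull-back of the universal family along `gγ = 1 × Spec γ⁻¹`) — polarisations (`hlam`) and level sections (`hlvl`) matched — and wants, at every special sheet point
`s′` with `s′ ≫ g = Spec σ ≫ x`, the PULLED-BACK identity `(F′ ≫ E) ×_{S′} s′ = (E ≫ (F ×_S S′)) ×_{S′} s′` for the two `𝒪_F`-actions; (R-CM-1)+(R-CM-2) (★
`F0P6aSpecialFibreConjugationCentralTwist`) and (R-CM-3) speak FIBRE currency.  This file turns `E`'s fibre into the `e` of (R-CM-3) — `e := E_{s′} ≫ ((B ×_S S′)_{s′} ≅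
B_{s′ ≫ g}) ≫ (B_{s′ ≫ g} ≅ B_{Spec σ ≫ x})` — derives its level clause `he` from `hlvl` and its `λ`-witness clause `heΘ` from `hlam` ([MumfordAV1970] §23
`Λ(ψ^*L) = ψ̂ ∘ Λ(L) ∘ ψ` along `E⁻¹`, ★ `IsLambdaOfAt.pullback_dualIsogeny`; base change ★ `IsLambdaOfAt.of_baseChange`; point equality), and reads the conclusion
back through the naturality of the two identifications (★ `fibreHom_baseChangeHom_comp_fibreBaseChangeIso_hom`, ★ `fibreHom_comp_fibreCongrPtIso_hom`).
HC_CM is proved only modulo the printed citations (2 remaining named inputs hLiu418 24832, h413 24833) until rung 0 closes; generic, count-neutral.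

* §1 `IsLambdaOfAt.of_globalIso_baseChange` — `λ`-witness transport along a global iso of polarised abelian schemes onto a base change, at a point
  (reduced locally Noetherian base: `𝟙^∨ = 𝟙` ★ `dualIsogenyOver_id'`);
  `IsLambdaOfAt.along_fibreCongrPtIso` — the point-equality step (twin of ★ `IsLambdaOfAt.along_fibreCongrIso` for ★ `fibreCongrPtIso`).
* §2 **`pullback_map_comp_eq_of_lifts_of_globalIso`** — THE HEAD ((B3) at one special sheet point from (R-CM-1)+(R-CM-2)+(R-CM-3)).

## References
* [Milne2005ShimuraVarieties] J. S. Milne, *Introduction to Shimura varieties* (2005), §14 Prop. 14.12 p. 125, §6 Thm. 6.11 pp. 74–75.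
* [MumfordFogartyKirwan1994] D. Mumford, J. Fogarty, F. Kirwan, *Geometric Invariant Theory*, 3rd ed. (1994), Ch. 6 §2 Def. 6.2–6.3 (p. 120), Ch. 7 §2 Def. 7.2 (p. 129), Ch. 7 §3.
* [MumfordAV1970] D. Mumford, *Abelian Varieties* (1970), §23 Thm. 2 (p. 231), §15 Thm. 1 (p. 143).
* [GortzWedhorn2020] U. Görtz, T. Wedhorn, *Algebraic Geometry I*, 2nd ed. (2020), Section (4.7), Prop. 4.16.
-/

set_option autoImplicit false

noncomputable section

universe u

open Matrix CategoryTheory CategoryTheory.Limits AlgebraicGeometry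
open scoped MonObj
open Literature.AlgebraicGeometry.Motives (AbelianVariety AlgPoints CartierDivisor)
open Literature.AlgebraicGeometry.AbelianSchemes (AbelianSchemeOver)
open Literature.AlgebraicGeometry.AbelianSchemes.AbelianSchemeOver (fibreHom baseChangeHom)
open Literature.NumberTheory.Automorphic (siegelUpperHalfSpace)

/-! ### §1 Transport of a `λ`-witness along a global isomorphism onto a base change; the point-equality step -/

namespace Literature.AlgebraicGeometry.AbelianSchemes.AbelianSchemeOver

section GlobalIso

variable {S S' : Scheme.{u}} {B : AbelianSchemeOver S} {D : B.DualPair} {lam : B.X ⟶ D.hat.X}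
  (g : S' ⟶ S) {B' : AbelianSchemeOver S'} {D' : B'.DualPair}
  (E : B'.X ≅ (B.baseChange g).X) [IsMonHom E.hom]
  {Ω : Type u} [Field Ω] (s' : Spec (.of Ω) ⟶ S')

/-- The fibre at `s′` of the inverse of an isomorphism of abelian schemes is dominant (it is an isomorphism of the fibres).
[cite: GortzWedhorn2020, Section (4.7), Prop. 4.16] -/
theorem isDominant_toSchemeHom_fibreHom_iso_inv :
    IsDominant (AbelianVariety.Hom.toSchemeHom (fibreHom E.inv s')) := by
  have h₁ : fibreHom E.inv s' ≫ fibreHom E.hom s' = 𝟙 _ := by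
    rw [← fibreHom_comp]; exact (fibreHom_congr (h := E.inv_hom_id) (s := s')).trans (fibreHom_id s')
  have h₂ : fibreHom E.hom s' ≫ fibreHom E.inv s' = 𝟙 _ := by
    rw [← fibreHom_comp]; exact (fibreHom_congr (h := E.hom_inv_id) (s := s')).trans (fibreHom_id s')
  exact AbelianVariety.isDominant_toSchemeHom_iso_hom ⟨fibreHom E.inv s', fibreHom E.hom s', h₁, h₂⟩

/-- **`λ`-WITNESS TRANSPORT ALONG A GLOBAL ISO ONTO A BASE CHANGE, AT A POINT.**  Let `E : B′ ≅ B ×_S S′` be an isomorphism of abelian schemes over `S′` (a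
homomorphism) matching the polarisations, `E ≫ (λ ×_S S′) ≫ E^∨ = λ′` (`hlam`, the tuple-iso clause of the E-sheet road).  If `Θ₂` witnesses `λ̄′ = Λ(𝒪(Θ₂))` at `s′`,
then `(E⁻¹_{s′})^*Θ₂` witnesses `λ̄ ×_S S′ = Λ(𝒪(·))` at `s′` — [MumfordAV1970] §23 «`Λ(ψ^*L) = ψ̂ ∘ Λ(L) ∘ ψ`» for `ψ = E⁻¹` (★ `IsLambdaOfAt.pullback_dualIsogeny`), where
`E⁻¹ ≫ λ′ ≫ (E⁻¹)^∨ = λ ×_S S′` by `hlam` and the functoriality of the dual morphism (★ `dualIsogenyOver_comp`, ★ `dualIsogenyOver_id'`).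
[cite: MumfordAV1970, §23 (Thm. 2, p. 231)] [cite: MumfordFogartyKirwan1994, Ch. 6 §2 Definition 6.2–6.3 (p. 120)] -/
theorem IsLambdaOfAt.of_globalIso_baseChange [IsReduced S'] [IsLocallyNoetherian S'] (pol : B.Polarization D) (pol' : B'.Polarization D')
    (hlam : E.hom ≫ (pol.baseChange g).lam ≫ DualPair.dualIsogenyOver E.hom D' (D.baseChange g) = pol'.lam)
    {Θ₂ : CartierDivisor (B'.fibre s').toAbelianVariety.X.left} (hΘ₂ : B'.IsLambdaOfAt s' D' pol'.lam Θ₂) :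
    haveI := isDominant_toSchemeHom_fibreHom_iso_inv g E s'
    (B.baseChange g).IsLambdaOfAt s' (D.baseChange g) (pol.baseChange g).lam
      (Θ₂.pullback (AbelianVariety.Hom.toSchemeHom (fibreHom E.inv s'))) := by
  haveI := isDominant_toSchemeHom_fibreHom_iso_inv g E s'
  haveI := pol'.isMonHom
  -- Mumford §23 along `ψ := E⁻¹`
  have h := IsLambdaOfAt.pullback_dualIsogeny E.inv (D.baseChange g) D' s' pol'.lam Θ₂ hΘ₂
  -- `(E)^∨ ≫ (E⁻¹)^∨ = 𝟙`
  have h1 : DualPair.dualIsogenyOver E.hom D' (D.baseChange g) ≫ DualPair.dualIsogenyOver E.inv (D.baseChange g) D' = 𝟙 _ := by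
    rw [← DualPair.dualIsogenyOver_comp]
    exact (DualPair.dualIsogenyOver_congr (D.baseChange g) (D.baseChange g) E.inv_hom_id).trans
      (DualPair.dualIsogenyOver_id' (D.baseChange g) (pol.baseChange g).nonempty_unitHatSlice_iso)
  -- `E⁻¹ ≫ λ′ ≫ (E⁻¹)^∨ = λ ×_S S′`
  have hcomp : E.inv ≫ pol'.lam ≫ DualPair.dualIsogenyOver E.inv (D.baseChange g) D' = (pol.baseChange g).lam := by
    calc E.inv ≫ pol'.lam ≫ DualPair.dualIsogenyOver E.inv (D.baseChange g) D'
        = E.inv ≫ (E.hom ≫ (pol.baseChange g).lam ≫ DualPair.dualIsogenyOver E.hom D' (D.baseChange g)) ≫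
            DualPair.dualIsogenyOver E.inv (D.baseChange g) D' := by rw [hlam]
      _ = (E.inv ≫ E.hom) ≫ (pol.baseChange g).lam ≫
            (DualPair.dualIsogenyOver E.hom D' (D.baseChange g) ≫ DualPair.dualIsogenyOver E.inv (D.baseChange g) D') := by
          simp only [Category.assoc]
      _ = (pol.baseChange g).lam := by rw [E.inv_hom_id, h1, Category.id_comp, Category.comp_id]
  rw [hcomp] at h
  exact h

variable {s₁ s₂ : Spec (.of Ω) ⟶ S}

/-- **The point-equality step for ★ `fibreCongrPtIso`**: for `h : s₁ = s₂`, `λ̄ = Λ(𝒪(Θ))` at `s₁` implies `λ̄ = Λ(𝒪((c⁻¹)^*Θ))` at `s₂` along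
`c = fibreCongrPtIso h : B_{s₁} ≅ B_{s₂}` (twin of ★ `IsLambdaOfAt.along_fibreCongrIso`; after `subst` the map is the identity and `(𝟙)^*Θ ∼ Θ`).
[cite: MumfordFogartyKirwan1994, Ch. 6 §2 Definition 6.2–6.3 (p. 120)] [cite: GortzWedhorn2020, Section (4.7), Prop. 4.16] -/
theorem IsLambdaOfAt.along_fibreCongrPtIso (h : s₁ = s₂) {Θ : CartierDivisor (B.fibre s₁).toAbelianVariety.X.left}
    (hΘ : B.IsLambdaOfAt s₁ D lam Θ) :
    haveI : IsDominant (AbelianVariety.Hom.toSchemeHom (B.fibreCongrPtIso h).inv) :=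
      AbelianVariety.isDominant_toSchemeHom_iso_hom (B.fibreCongrPtIso h).symm
    B.IsLambdaOfAt s₂ D lam (Θ.pullback (AbelianVariety.Hom.toSchemeHom (B.fibreCongrPtIso h).inv)) := by
  haveI : IsDominant (AbelianVariety.Hom.toSchemeHom (B.fibreCongrPtIso h).inv) :=
    AbelianVariety.isDominant_toSchemeHom_iso_hom (B.fibreCongrPtIso h).symm
  subst h
  have hid : AbelianVariety.Hom.toSchemeHom (B.fibreCongrPtIso (rfl : s₁ = s₁)).inv = 𝟙 _ := by
    simp only [fibreCongrPtIso, eqToIso_refl, Iso.refl_inv]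
    rfl
  exact IsLambdaOfAt.of_sameDivisor B D lam s₁
    (((Θ.pullback_congr_sameDivisor hid).trans Θ.pullback_id_sameDivisor).symm) hΘ

end GlobalIso

end Literature.AlgebraicGeometry.AbelianSchemes.AbelianSchemeOver

/-! ### §2 The head: (B3) at one special sheet point -/

namespace Literature.AlgebraicGeometry.ModuliOfAbelianVarieties

namespace SiegelAdelicMarking

open SiegelModuli
open Literature.AlgebraicGeometry.AbelianSchemes.AbelianSchemeOver (IsLambdaOfAt.of_globalIso_baseChange IsLambdaOfAt.along_fibreCongrPtIso
  isDominant_toSchemeHom_fibreHom_iso_inv fibreHom_comp fibreHom_id fibreHom_congr map_fibreHom_restrictPt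
  fibreHom_baseChangeHom_comp_fibreBaseChangeIso_hom fibreHom_comp_fibreCongrPtIso_hom isMonHom_baseChangeHom)

variable {g : ℕ} {δ : Fin g → ℕ} {J : C0pm δ} {a k : gspFinAdelic δ}
variable {N : ℕ} {S : Scheme} {B : AbelianSchemeOver S} {s : Spec (CommRingCat.of ℂ) ⟶ S}
  {D : B.DualPair} {φ : B.LevelStructure g N} {r : gspFinAdelic δ} {Z : Matrix (Fin g) (Fin g) ℂ}
variable {S' : Scheme} [IsReduced S'] [IsLocallyNoetherian S'] {B' : AbelianSchemeOver S'} {s' : Spec (CommRingCat.of ℂ) ⟶ S'}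
  {D' : B'.DualPair} {φ' : B'.LevelStructure g N}

set_option maxHeartbeats 400000 in
/-- **(B3) AT ONE SPECIAL SHEET POINT — the fibre of the GLOBAL tuple isomorphism intertwines the two actions.**  Data: ONE polarised abelian scheme `(B, λ = pol.lam, φ)`
over `S` (the universal pull-back `P`) with the kernel's CM datum `(m₁, Θ₁, Λ₁)` at the complex point `s` (σ1 at `x = ℓ_{τE}(σ⁻¹•z₀)`); a base change `gS : S′ → S`
(`gγ = 1 × Spec γ⁻¹`); a SECOND polarised abelian scheme `(B′, λ′ = pol′.lam, φ′)` over `S′` (the Serre-tensor tuple) with an admissibility datum `(m₂, Θ₂, Λ₂)`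
at the complex point `s′` (`ℓ_{τE} z₀`; organs #42 ∕ (B1)) lying over the twisted point, `s′ ≫ gS = Spec σ ≫ s` (`hpt`); a GLOBAL isomorphism
`E : B′ ≅ B ×_S S′` of abelian schemes matching polarisations (`hlam`) and level sections (`hlvl`) — LEG-E's fine-moduli iso; the CM homomorphism
`f : (B_s)^σ → B′_{s′}` with the `K_δ(N)`-twisted reading (`hf`, (R-CM-1)) intertwining the fibres of two global endomorphisms `F` of `B` and `F′` of `B′`
(`hint`, (R-CM-2)).  THEN **`(F′ ≫ E) ×_{S′} s′ = (E ≫ (F ×_S S′)) ×_{S′} s′`** — the `h` of ★ (R-RIG) `RecordSystemGS.forall_comp_eq_comp_of_forall_specialPoint_sheet`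
at that point.  Proof: the fibre iso `e := E_{s′} ≫ ((B ×_S S′)_{s′} ≅ B_{s′ ≫ gS}) ≫ (B_{s′ ≫ gS} ≅ B_{Spec σ ≫ s})` carries the level sections (`hlvl` + ★
`map_fibreBaseChangeIso_restrictPt_sectionBaseChange` + ★ `map_fibreCongrPtIso_restrictPt`) and pushes `Θ₂` to a `λ`-witness (§1 + ★ `IsLambdaOfAt.of_baseChange` +
point equality), so ★ (R-CM-3) `comp_iso_hom_eq_iso_hom_comp_fibreHom_of_lifts` gives `F′_{s′} ≫ e = e ≫ F_{Spec σ ≫ s}`; read back through the naturality of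
the two identifications. [cite: Milne2005ShimuraVarieties, §14 Prop. 14.12 p. 125; §6 Thm. 6.11 pp. 74–75] [cite: MumfordFogartyKirwan1994, Ch. 7 §2 Definition 7.2 (p. 129) and Ch. 7 §3 (lemma of Serre)] -/
theorem pullback_map_comp_eq_of_lifts_of_globalIso (hg : 0 < g) (hδ : IsPolarizationType δ) (hN : 3 ≤ N)
    (σ : ℂ ≃ₐ[ℚ] ℂ) (pol : B.Polarization D)
    -- the CM datum at `s`
    {Θ₁ : CartierDivisor (B.fibre s).toAbelianVariety.X.left} (h₁ : B.IsLambdaOfAt s D pol.lam Θ₁)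
    (Λ₁ : φ.SymplecticLift s Θ₁ δ) (m₁ : SiegelAdelicMarking J a (B.fibre s).toAbelianVariety)
    (hΛ₁ : ∀ ⦃M : ℕ⦄, N ∣ M → M ≠ 0 → ∀ (x : Fin g ⊕ Fin g → ZMod M) (v : Fin g ⊕ Fin g → ℚ),
      AdelicCongr ((a⁻¹ : gspFinAdelic δ) : GL (Fin g ⊕ Fin g) finAdeleQ) 1 v (fun i => ((x i).val : ℚ) / M) →
        ((Λ₁.lift M (Multiplicative.ofAdd x)) : (B.fibre s).toAbelianVariety.Points ℂ) = m₁.r v)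
    -- the base change and the second family at `s′` over the twisted point
    (gS : S' ⟶ S) (hpt : s' ≫ gS = AbelianSchemeOver.specTwist σ.toRingEquiv ≫ s) (pol' : B'.Polarization D')
    (hr : r ∈ principalLevelSubgroup δ 1) (hZ : Z ∈ siegelUpperHalfSpace g)
    (m₂ : SiegelAdelicMarking ⟨jOfSiegel δ Z, SiegelComplexRecordSystem.jOfSiegel_mem_C0pm hδ.1 hZ⟩ r (B'.fibre s').toAbelianVariety)
    {Θ₂ : CartierDivisor (B'.fibre s').toAbelianVariety.X.left} (hΘ₂ : B'.IsLambdaOfAt s' D' pol'.lam Θ₂)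
    (Λ₂ : φ'.SymplecticLift s' Θ₂ δ)
    (hΛ₂ : ∀ ⦃M : ℕ⦄, N ∣ M → M ≠ 0 → ∀ (x : Fin g ⊕ Fin g → ZMod M) (v : Fin g ⊕ Fin g → ℚ),
      AdelicCongr ((r⁻¹ : gspFinAdelic δ) : GL (Fin g ⊕ Fin g) finAdeleQ) 1 v (fun i => ((x i).val : ℚ) / M) →
        ((Λ₂.lift M (Multiplicative.ofAdd x)) : (B'.fibre s').toAbelianVariety.Points ℂ) = m₂.r v)
    -- the GLOBAL tuple isomorphism
    (E : B'.X ≅ (B.baseChange gS).X) [IsMonHom E.hom]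
    (hlam : E.hom ≫ (pol.baseChange gS).lam ≫ AbelianSchemeOver.DualPair.dualIsogenyOver E.hom D' (D.baseChange gS) = pol'.lam)
    (hlvl : ∀ i : Fin g ⊕ Fin g, φ'.σ i ≫ E.hom = (φ.baseChange gS).σ i)
    -- the CM homomorphism with the twisted reading and its intertwining
    (f : ((B.fibre s).toAbelianVariety).conjugate σ.toRingEquiv ⟶ (B'.fibre s').toAbelianVariety)
    (hk : k ∈ principalLevelSubgroup δ N)
    (hf : ∀ v w : Fin g ⊕ Fin g → ℚ,
      AdelicCongr ((k * a⁻¹ : gspFinAdelic δ) : GL (Fin g ⊕ Fin g) finAdeleQ)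
          ((r⁻¹ : gspFinAdelic δ) : GL (Fin g ⊕ Fin g) finAdeleQ) v w →
        AlgPoints.map f.hom.hom.hom ((B.fibre s).toAbelianVariety.conjPoints σ.toRingEquiv (m₁.r v)) = m₂.r w)
    (F : B.X ⟶ B.X) [IsMonHom F] (F' : B'.X ⟶ B'.X) [IsMonHom F']
    (hint : AbelianVariety.Hom.conjugate σ.toRingEquiv (fibreHom F s) ≫ f = f ≫ fibreHom F' s') :
    (Over.pullback s').map (F' ≫ E.hom) = (Over.pullback s').map (E.hom ≫ baseChangeHom F gS) := by
  haveI := pol.isMonHom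
  haveI := isMonHom_baseChangeHom F gS
  haveI := isDominant_toSchemeHom_fibreHom_iso_inv gS E s'
  -- the fibre iso `E_{s′}` and the composite `e`
  have hEi : fibreHom E.hom s' ≫ fibreHom E.inv s' = 𝟙 _ := by
    rw [← fibreHom_comp]; exact (fibreHom_congr (h := E.hom_inv_id) (s := s')).trans (fibreHom_id s')
  have hEi' : fibreHom E.inv s' ≫ fibreHom E.hom s' = 𝟙 _ := by
    rw [← fibreHom_comp]; exact (fibreHom_congr (h := E.inv_hom_id) (s := s')).trans (fibreHom_id s')
  let eE : (B'.fibre s').toAbelianVariety ≅ ((B.baseChange gS).fibre s').toAbelianVariety :=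
    ⟨fibreHom E.hom s', fibreHom E.inv s', hEi, hEi'⟩
  let e : (B'.fibre s').toAbelianVariety ≅ (B.fibre (AbelianSchemeOver.specTwist σ.toRingEquiv ≫ s)).toAbelianVariety :=
    eE ≪≫ B.fibreBaseChangeIso gS s' ≪≫ B.fibreCongrPtIso hpt
  -- `e` carries the level sections
  have he : ∀ i : Fin g ⊕ Fin g, AlgPoints.map e.hom.hom.hom.hom (B'.restrictPt s' (φ'.σ i)) =
      B.restrictPt (AbelianSchemeOver.specTwist σ.toRingEquiv ≫ s) (φ.σ i) := by
    intro i
    change AlgPoints.map ((fibreHom E.hom s').hom.hom.hom ≫ (B.fibreBaseChangeIso gS s').hom.hom.hom.hom ≫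
        (B.fibreCongrPtIso hpt).hom.hom.hom.hom) (B'.restrictPt s' (φ'.σ i)) = _
    rw [AlgPoints.map_comp_apply, AlgPoints.map_comp_apply, map_fibreHom_restrictPt s' E.hom (φ'.σ i), hlvl i,
      AbelianSchemeOver.LevelStructure.baseChange_σ, B.map_fibreBaseChangeIso_restrictPt_sectionBaseChange gS s' (φ.σ i),
      B.map_fibreCongrPtIso_restrictPt hpt (φ.σ i)]
  -- `e` pushes `Θ₂` to a `λ`-witness at the twisted point
  have heΘ : haveI := AbelianVariety.isDominant_toSchemeHom_iso_hom e.symm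
      B.IsLambdaOfAt (AbelianSchemeOver.specTwist σ.toRingEquiv ≫ s) D pol.lam
        (Θ₂.pullback (AbelianVariety.Hom.toSchemeHom e.symm.hom)) := by
    haveI := AbelianVariety.isDominant_toSchemeHom_iso_hom e.symm
    haveI hb : IsDominant (AbelianVariety.Hom.toSchemeHom (B.fibreBaseChangeIso gS s').inv) :=
      AbelianVariety.isDominant_toSchemeHom_iso_hom (B.fibreBaseChangeIso gS s').symm
    haveI hc : IsDominant (AbelianVariety.Hom.toSchemeHom (B.fibreCongrPtIso hpt).inv) :=
      AbelianVariety.isDominant_toSchemeHom_iso_hom (B.fibreCongrPtIso hpt).symm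
    -- §1 along `E`, then ★ base change, then the point equality
    have h1 := IsLambdaOfAt.of_globalIso_baseChange gS E s' pol pol' hlam hΘ₂
    have h2 := AbelianSchemeOver.IsLambdaOfAt.of_baseChange (A := B) (g := gS) (t := s') (D := D) (lam := pol.lam) _ h1
    have h3 := IsLambdaOfAt.along_fibreCongrPtIso (D := D) (lam := pol.lam) hpt h2
    -- the three pull-backs are the pull-back along `e⁻¹`
    refine AbelianSchemeOver.IsLambdaOfAt.of_sameDivisor B D pol.lam _ ?_ h3
    refine ((CartierDivisor.pullback_pullback_sameDivisor _ _ _).trans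
      ((CartierDivisor.pullback_pullback_sameDivisor _ _ _).trans (CartierDivisor.pullback_congr_sameDivisor _ ?_)))
    rfl
  -- (R-CM-3): the tuple iso intertwines
  have key := comp_iso_hom_eq_iso_hom_comp_fibreHom_of_lifts hg hδ hN σ h₁ Λ₁ m₁ hΛ₁ hr hZ m₂ Λ₂ hΛ₂ e he heΘ f hk hf
    F (fibreHom F' s') hint
  -- read back through the two identifications
  have n1 := fibreHom_baseChangeHom_comp_fibreBaseChangeIso_hom gS s' F
  have n2 := fibreHom_comp_fibreCongrPtIso_hom hpt F
  have key' : fibreHom F' s' ≫ fibreHom E.hom s' ≫ (B.fibreBaseChangeIso gS s').hom ≫ (B.fibreCongrPtIso hpt).hom =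
      (fibreHom E.hom s' ≫ fibreHom (baseChangeHom F gS) s') ≫ (B.fibreBaseChangeIso gS s').hom ≫ (B.fibreCongrPtIso hpt).hom := by
    have hk' : fibreHom F' s' ≫ (fibreHom E.hom s' ≫ (B.fibreBaseChangeIso gS s').hom ≫ (B.fibreCongrPtIso hpt).hom) =
        (fibreHom E.hom s' ≫ (B.fibreBaseChangeIso gS s').hom ≫ (B.fibreCongrPtIso hpt).hom) ≫
          fibreHom F (AbelianSchemeOver.specTwist σ.toRingEquiv ≫ s) := key
    rw [hk']
    simp only [Category.assoc]
    rw [← n2, ← Category.assoc (B.fibreBaseChangeIso gS s').hom, ← n1, Category.assoc]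
  have key'' : fibreHom F' s' ≫ fibreHom E.hom s' = fibreHom E.hom s' ≫ fibreHom (baseChangeHom F gS) s' := by
    have hm : (fibreHom F' s' ≫ fibreHom E.hom s') ≫ ((B.fibreBaseChangeIso gS s').hom ≫ (B.fibreCongrPtIso hpt).hom) =
        (fibreHom E.hom s' ≫ fibreHom (baseChangeHom F gS) s') ≫
          ((B.fibreBaseChangeIso gS s').hom ≫ (B.fibreCongrPtIso hpt).hom) := by
      simpa only [Category.assoc] using key'
    exact (cancel_mono _).1 hm
  have hfin : fibreHom (F' ≫ E.hom) s' = fibreHom (E.hom ≫ baseChangeHom F gS) s' := by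
    rw [fibreHom_comp, fibreHom_comp]
    exact key''
  exact congrArg (fun φ => φ.hom.hom.hom) hfin

end SiegelAdelicMarking

end Literature.AlgebraicGeometry.ModuliOfAbelianVarieties

end
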